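import Literature.IUT.HodgeArakelov.EtaleThetaDataOfSettingRootHypDelta
import Literature.AnabelianGeometry.EtaleTheta.TemperedRigidity

/-!
# GAP row G-w5d169-2, glue (E5b): the pair transport `h1TopAut (α, γ^Θ; Δ_Θ)` at `Π^tp_X̲̲` IS the pull-back of
# [EtTh] Thm 1.6's «isomorphism of cohomology groups induced by `γ`» — so `hroot` follows from the §1-level statement
# «`γ` (extending `α`) maps `η̈^Θ` to a `Π^tp_X̲̲`-conjugate of `η̈^Θ`»

S. Mochizuki, *The étale theta function …*, Publ. RIMS **45** (2009) [EtTh] (refereed): Thm. 1.6 (iii) p. 24 ("The isomorphism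
of cohomology groups induced by `γ` maps the classes `O^×_{K̈α}·η̈^Θ_α` … to some `Π^tp_{Xβ}/Π^tp_{Yβ} ≅ Z`-conjugate of …
`O^×_{K̈β}·η̈^Θ_β`"), Prop. 2.4 p. 38 (extension of automorphisms of `Π^tp_X̲̲` to `Π^tp_X`), Cor. 2.19 (iii) p. 65
[cite: MochizukiEtTh2009, Thm 1.6 (iii) p.24].  S. Mochizuki, *Inter-universal Teichmüller theory II*, kurims manuscript
(Dec. 2020), Prop. 1.4 p. 27 / Prop. 3.4 (i) p. 91 (claim key `Mochizuki2012`, DISPUTED, D-0012) [cite: Mochizuki2012, Prop 1.4 p.27].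
Transport of structure in group cohomology [cite: NeukirchSchmidtWingberg2008, I §5].

abc-iut cell (WAVE-4 seat abc-iut-w4-d041 gen 7; GAP-LEDGER row **G-w5d169-2**, (E5b) of the route of record D-G-w5d169-2;
node IUTchII:Prop3.4(i), binder (P4) `hroot` of abc-iut-w5-d169).  PROOF-ONLY sequel to `EtaleThetaDataOfSettingRootHypDelta.lean`
(this seat) over abc-iut-L2-t1's `TemperedRigidity.lean` (`ThetaSetting.Thm16i`, `ThetaCompanion`, `transport`).  For
`γ ∈ Aut_top(Π^tp_X)` EXTENDING `α ∈ Aut_top(Π^tp_X̲̲)` (`hext`), with `γ(Π^tp_Ÿ) = Π^tp_Ÿ` (`Thm16i`) and a theta companion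
`c` (`γ^Θ := c.thetaIso`):
* `thetaIso_phi_of_extends` / `mem_PiYdd_iff_of_extends` — `γ^Θ` is an X-level companion of `α` and `α` stabilises `Π^tp_Ÿ̲̲`;
* **`h1TopAut_comap_eq_comap_transport`** — `h1TopAut (α, γ^Θ; Δ_Θ) ∘ comap_{Π^tp_X̲̲ ↪ Π^tp_X} = comap ∘ transport c h` on
  `H¹(Π^tp_Ÿ, Δ_Θ)` (both are `f ↦ γ^Θ ∘ f ∘ γ⁻¹`, read on `Π^tp_Ÿ̲̲ ⊆ Π^tp_X̲̲`);
* **`rootHyp_of_transport_eq_conj`** — `hroot` at `α` from «`transport c h (η̈^Θ) = conj_τ (η̈^Θ)` for some `τ ∈ Π^tp_X̲̲`»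
  (pulled back to `Π^tp_Ÿ̲̲`; GtpYdd-level convenience `rootHyp_of_transport_eq_conj'`), and the all-`α` package
  `rootHyp_of_forall_extends_transport` — the EXACT shape in which (E1) extension [Prop 2.4], (E2) companion [Thm 1.6 (ii)],
  (E3) F-0587 `Thm16iii`, (E4) F-0512/F-0513 `Thm110i`/`Thm110iUnique` + the zero-label/sign step deliver G-w5d169-2.
Nothing here asserts anything of [IUTchII] or [EtTh] beyond what is proved; no side taken on [IUTchIII] Cor. 3.12; typed ≠ proved.
-/

noncomputable section

open Topology

namespace Literature.IUT.HodgeArakelov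

namespace EtaleThetaDataOfSetting

open Literature.AnabelianGeometry.EtaleTheta (ContH1 contCocycles)
open Literature.AnabelianGeometry.EtaleTheta CohomologySystemOfContH1

variable {p : ℕ} [Fact p.Prime] {D : Literature.AnabelianGeometry.EtaleTheta.ThetaSetting p}
  {E : D.EtaleThetaData} {l : ℕ} (C : E.DoubleUnderline l)
  (α : (Pi C) ≃ₜ* (Pi C)) (γ : D.PiTemp ≃ₜ* D.PiTemp) (hext : ∀ x : Pi C, ((α x : Pi C) : D.PiTemp) = γ (x : D.PiTemp))
  (h : ThetaSetting.Thm16i γ) (c : ThetaSetting.ThetaCompanion γ)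

/-! ### 1. `γ^Θ` is an X-level companion of `α`; `α` stabilises `Π^tp_Ÿ̲̲` -/

include hext in
/-- `γ^Θ ∘ φ = φ ∘ α` on `Π^tp_X̲̲` (from `(·)^Θ ∘ γ = γ^Θ ∘ (·)^Θ` and `γ|_{Π^tp_X̲̲} = α`). [cite: MochizukiEtTh2009, Thm 1.6 (ii) p.24] -/
theorem thetaIso_phi_of_extends (g : Pi C) : c.thetaIso (phi C g) = phi C (α g) := by
  change c.thetaIso.toMulEquiv (D.toTheta (g : D.PiTemp)) = D.toTheta ((α g : Pi C) : D.PiTemp)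
  rw [← c.comm, hext]
  rfl

include hext in
/-- `γ⁻¹` restricted to `Π^tp_X̲̲` is `α⁻¹`. [cite: MochizukiEtTh2009, Prop 2.4 p.38] -/
theorem symm_coe_of_extends (y : Pi C) : γ.symm (y : D.PiTemp) = ((α.symm y : Pi C) : D.PiTemp) := by
  apply γ.injective
  rw [ContinuousMulEquiv.apply_symm_apply, ← hext, ContinuousMulEquiv.apply_symm_apply]

include hext h in
/-- `α` stabilises `Π^tp_Ÿ̲̲ = Π^tp_Ÿ ∩ Π^tp_X̲̲` (iff form), from `γ(Π^tp_Ÿ) = Π^tp_Ÿ`. [cite: MochizukiEtTh2009, Thm 1.6 (i) p.24] -/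
theorem mem_PiYdd_iff_of_extends (x : Pi C) : x ∈ PiYdd C ↔ α x ∈ PiYdd C := by
  have key : ∀ y : D.PiTemp, y ∈ D.GtpYdd ↔ γ y ∈ D.GtpYdd :=
    mem_iff_apply_mem_of_map_eq γ.toMulEquiv D.GtpYdd h
  change (x : D.PiTemp) ∈ D.GtpYdd ⊓ C.Huu ↔ ((α x : Pi C) : D.PiTemp) ∈ D.GtpYdd ⊓ C.Huu
  rw [Subgroup.mem_inf, Subgroup.mem_inf]
  constructor
  · rintro ⟨hx, -⟩
    refine ⟨?_, (α x).2⟩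
    rw [hext, ← key]
    exact hx
  · rintro ⟨hx, -⟩
    refine ⟨?_, x.2⟩
    rw [hext, ← key] at hx
    exact hx

/-- A theta companion carries `Δ_Θ` into `Δ_Θ`. [cite: MochizukiEtTh2009, Thm 1.6 (ii) p.24] -/
theorem thetaIso_mem_deltaTheta {γ₀ : D.PiTemp ≃ₜ* D.PiTemp} (c₀ : ThetaSetting.ThetaCompanion γ₀) (a : D.GtpTheta)
    (ha : a ∈ D.DeltaTheta) : c₀.thetaIso a ∈ D.DeltaTheta :=
  c₀.apply_mem ⟨a, ha⟩

/-! ### 2. The pair transport at `Π^tp_X̲̲` is the pull-back of Thm 1.6's transport -/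

include hext in
/-- **(E5b) `h1TopAut (α, γ^Θ; Δ_Θ) ∘ comap = comap ∘ transport c h`**: abc-iut-L6-t1's pair transport on
`H¹(Π^tp_Ÿ̲̲ ⊓ ⊤, Δ_Θ)` (over `Π^tp_X̲̲`) of a class pulled back from `H¹(Π^tp_Ÿ, Δ_Θ)` (over `Π^tp_X`) is the pull-back of its
[EtTh] Thm 1.6 transport `[f] ↦ [γ^Θ ∘ f ∘ γ⁻¹]` — both cocycles are `y ↦ γ^Θ(f(γ⁻¹ y))` on `Π^tp_Ÿ̲̲`.
[cite: MochizukiEtTh2009, Thm 1.6 (iii) p.24] -/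
theorem h1TopAut_comap_eq_comap_transport (hH : ∀ x, x ∈ PiYdd C ↔ α x ∈ PiYdd C) (z : D.H1 D.GtpYdd) :
    h1TopAut (phi C) D.DeltaTheta (PiYdd C) α c.thetaIso (thetaIso_phi_of_extends C α γ hext c)
        (thetaIso_mem_deltaTheta c) hH
        (ContH1.comap D.toTheta D.DeltaTheta C.Huu.subtype continuous_subtype_val
          (map_subtype_piYdd_inf_le_GtpYdd C ⊤) z) =
      ContH1.comap D.toTheta D.DeltaTheta C.Huu.subtype continuous_subtype_val
        (map_subtype_piYdd_inf_le_GtpYdd C ⊤) (ThetaSetting.transport c h z) := by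
  induction z using QuotientGroup.induction_on with
  | H f =>
    change QuotientGroup.mk (ContH1Aut.autCocycle (phi C) D.DeltaTheta α c.thetaIso
        (thetaIso_phi_of_extends C α γ hext c) (thetaIso_mem_deltaTheta c) (symm_mem_inf_top (PiYdd C) α hH)
        (ContH1.comapCocycle D.toTheta D.DeltaTheta C.Huu.subtype continuous_subtype_val
          (map_subtype_piYdd_inf_le_GtpYdd C ⊤) f)) =
      QuotientGroup.mk (ContH1.comapCocycle D.toTheta D.DeltaTheta C.Huu.subtype continuous_subtype_val
        (map_subtype_piYdd_inf_le_GtpYdd C ⊤) (ThetaSetting.transportCocycle c h f))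
    congr 1
    apply Subtype.ext; funext y; apply Subtype.ext
    rw [ContH1Aut.coe_autCocycle_apply]
    exact congrArg (fun t : D.GtpYdd => (c.thetaIso ((f.1 t : D.DeltaTheta) : D.GtpTheta)))
      (Subtype.ext (symm_coe_of_extends C α γ hext (y : Pi C)).symm)

/-! ### 3. `hroot` from «`γ` maps `η̈^Θ` to a `Π^tp_X̲̲`-conjugate» -/

section Root

variable [(PiYdd C).Normal] [D.GtpYdd.Normal] (hq : IsQuotientMap D.toTheta) {N : ℕ+} (μ : D.CyclotomeMod l N)
  (hC : D.Compat) (hS : D.Sec2Hyps) (h15 : D.Prop15iii E hC) (L : C.CuspLabels) (R : RigidData.{0} N l)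
  (hR : R = C.rigidData μ hC hS h15 L) (h218i : R.Cor218_i)

include hext in
/-- **`hroot` at `α` from the [EtTh] §1 transport, pulled back to `Π^tp_Ÿ̲̲`**: if `γ ⊇ α` (with `γ(Π^tp_Ÿ) = Π^tp_Ÿ` and a theta
companion `c`) satisfies «the pull-back to `Π^tp_Ÿ̲̲ ⊆ Π^tp_X̲̲` of `transport c h (η̈^Θ)` is the pull-back of `conj_τ η̈^Θ`» for some
`τ ∈ Π^tp_X̲̲`, then `ρ^⊤_α η̲̈ = conj_τ η̲̈ + ε` with `l • ε = 0`. [cite: MochizukiEtTh2009, Thm 1.6 (iii) p.24] -/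
theorem rootHyp_of_transport_eq_conj (τ : Pi C)
    (hγ : ContH1.comap D.toTheta D.DeltaTheta C.Huu.subtype continuous_subtype_val
        (map_subtype_piYdd_inf_le_GtpYdd C ⊤) (ThetaSetting.transport c h E.etaDd) =
      ContH1.comap D.toTheta D.DeltaTheta C.Huu.subtype continuous_subtype_val
        (map_subtype_piYdd_inf_le_GtpYdd C ⊤) (ContH1.conj D.toTheta D.DeltaTheta (τ : D.PiTemp) E.etaDd)) :
    ∃ τ : Pi C, ∃ ε : (coh C).H1 ⊤, l • ε = 0 ∧
      autActTopOfCor218i C hq μ hC hS h15 L R hR h218i α (rootTop C) =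
        h1TopConjEquiv (phi C) (D.lDeltaTheta l) (PiYdd C) τ (rootTop C) + ε := by
  refine rootHyp_of_companion_delta C hq μ hC hS h15 L R hR h218i α c.thetaIso (thetaIso_phi_of_extends C α γ hext c)
    (thetaIso_mem_deltaTheta c) τ ?_
  rw [← hγ]
  exact h1TopAut_comap_eq_comap_transport C α γ hext h c _ E.etaDd

include hext in
/-- The same from the `Π^tp_Ÿ`-LEVEL statement «`transport c h (η̈^Θ) = conj_τ (η̈^Θ)` in `H¹(Π^tp_Ÿ, Δ_Θ)`», `τ ∈ Π^tp_X̲̲` — the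
literal Thm 1.6 (iii) output once the `O^×_{K̈}`-multiple is `1` (Thm 1.10 (i), zero label and sign fixed).
[cite: MochizukiEtTh2009, Thm 1.6 (iii) p.24] -/
theorem rootHyp_of_transport_eq_conj' (τ : Pi C)
    (hγ : ThetaSetting.transport c h E.etaDd = ContH1.conj D.toTheta D.DeltaTheta (τ : D.PiTemp) E.etaDd) :
    ∃ τ : Pi C, ∃ ε : (coh C).H1 ⊤, l • ε = 0 ∧
      autActTopOfCor218i C hq μ hC hS h15 L R hR h218i α (rootTop C) =
        h1TopConjEquiv (phi C) (D.lDeltaTheta l) (PiYdd C) τ (rootTop C) + ε :=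
  rootHyp_of_transport_eq_conj C α γ hext h c hq μ hC hS h15 L R hR h218i τ (by rw [hγ])

end Root

/-- **G-w5d169-2 via [EtTh] §1, packaged over all `α`**: if every `α ∈ Aut_top(Π^tp_X̲̲)` extends to some `γ ∈ Aut_top(Π^tp_X)` with
`γ(Π^tp_Ÿ) = Π^tp_Ÿ`, a theta companion, and `transport (η̈^Θ) = conj_τ (η̈^Θ)` pulled back to `Π^tp_Ÿ̲̲` for some `τ ∈ Π^tp_X̲̲`
(= (E1) ∧ (E2) ∧ (E3)/(E4) of D-G-w5d169-2), then abc-iut-w5-d169's binder `hroot` holds.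
[cite: MochizukiEtTh2009, Cor 2.19(iii) p.65] -/
theorem rootHyp_of_forall_extends_transport [(PiYdd C).Normal] [D.GtpYdd.Normal] (hq : IsQuotientMap D.toTheta)
    {N : ℕ+} (μ : D.CyclotomeMod l N) (hC : D.Compat) (hS : D.Sec2Hyps) (h15 : D.Prop15iii E hC) (L : C.CuspLabels)
    (R : RigidData.{0} N l) (hR : R = C.rigidData μ hC hS h15 L) (h218i : R.Cor218_i)
    (hE : ∀ α : (Pi C) ≃ₜ* (Pi C), ∃ (γ : D.PiTemp ≃ₜ* D.PiTemp)
      (_ : ∀ x : Pi C, ((α x : Pi C) : D.PiTemp) = γ (x : D.PiTemp)) (h : ThetaSetting.Thm16i γ)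
      (c : ThetaSetting.ThetaCompanion γ) (τ : Pi C),
      ContH1.comap D.toTheta D.DeltaTheta C.Huu.subtype continuous_subtype_val
          (map_subtype_piYdd_inf_le_GtpYdd C ⊤) (ThetaSetting.transport c h E.etaDd) =
        ContH1.comap D.toTheta D.DeltaTheta C.Huu.subtype continuous_subtype_val
          (map_subtype_piYdd_inf_le_GtpYdd C ⊤) (ContH1.conj D.toTheta D.DeltaTheta (τ : D.PiTemp) E.etaDd))
    (α : (Pi C) ≃ₜ* (Pi C)) :
    ∃ τ : Pi C, ∃ ε : (coh C).H1 ⊤, l • ε = 0 ∧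
      autActTopOfCor218i C hq μ hC hS h15 L R hR h218i α (rootTop C) =
        h1TopConjEquiv (phi C) (D.lDeltaTheta l) (PiYdd C) τ (rootTop C) + ε := by
  obtain ⟨γ, hext, h, c, τ, hγ⟩ := hE α
  exact rootHyp_of_transport_eq_conj C α γ hext h c hq μ hC hS h15 L R hR h218i τ hγ

end EtaleThetaDataOfSetting

end Literature.IUT.HodgeArakelov

end
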